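import Summits.SmoothPoincare4.SmoothPoincare4.Theses.SymplecticOrigami
import Summits.SmoothPoincare4.SmoothPoincare4.Theses.SymplecticCap
import Summits.SmoothPoincare4.SmoothPoincare4.Theorems.SymplecticOrigamiGromovRecognitionRelEndStubEndDoesNotReturnAux
import Summits.SmoothPoincare4.SmoothPoincare4.Theorems.SymplecticOrigamiGromovRecognitionRelEndStubEndDoesNotReturnAux2
import Literature.Geometry.Symplectic.GromovR4StdModel

/-!
# Stub `stub_endDoesNotReturn` of line `cross-cap-laurent` — the end does not return
(crux `SymplecticOrigami.GromovRecognitionRelEnd` ≡ `SymplecticCap.GromovRecognitionRelEnd`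
≡ `Literature.Geometry.Symplectic.gromov_recognitionR4_relEnd` by `Iff.rfl`,
item stmt-SmoothPoincare4-11009; third of three files)

**Statement** (`stub_endDoesNotReturn`, registered verbatim, Stub 1 of 6 of the skeleton). Let
`M` be a Hausdorff second-countable smooth 4-manifold (charts in `ℝ⁴`), `sf` a SMOOTH `2`-form,
`K ⊆ M`, `R : ℝ`, `ψ : M → ℝ⁴`, `χ : ℝ⁴ → M` with: every sub-end `K ∪ {‖ψ‖ ≤ R'}` (`R' ≥ R`)
compact (H5); `ψ` smooth on `Kᶜ` (H6); `χ` smooth on `{R < ‖z‖}` (H7); `ψ : Kᶜ → {R < ‖z‖}`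
bijective (H8) with `χ ∘ ψ = id` on `Kᶜ` (H9); and `sf = ψ*ω₀` on `Kᶜ` (H10,
`ω₀ = stdSymplecticForm`, derivatives as `mfderiv`). Then for every `R' > R` the truncation
`K ∪ {x ∈ Kᶜ | ‖ψ x‖ < R'}` is OPEN — the `∞`-side of the standard end does not accumulate on `K`.

**Proof.** By the topological dichotomy `noAccumulation_or_compactSpace` (first file; manifolds
charted on `ℝ⁴` are locally compact, `C^∞` maps are continuous) it suffices that `M` is NOT
compact, and that is the symplectic VOLUME COUNT `not_compactSpace_of_end`: by
`exists_nhds_volume_lt_top` (second file) every point of `M` has an open neighbourhood `U` whose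
end-piece `{w | R < ‖w‖, χ w ∈ U}` has finite Lebesgue measure (the chart matrix of the continuous
`sf` is bounded near the point, so `F = chart ∘ χ`, injective and smooth with `F*(sf-chart) = ω₀`,
has `|det DF| ≥ c > 0`, and `c · Leb ≤ Leb ∘ F` by Mathlib's change of variables); if `M` were
compact, finitely many `U` would cover `M`, so the end `{R < ‖w‖} = ⋃ pieces` would have finite
measure — but it has infinite measure (`volume_compl_closedBall_eq_top`). The refuter's analysis
(`Disproof.lean` §11) shows each of H10, `IsSmoothForm sf` and H5 is needed (the `S⁴` with a
stereographic end; the shear end), and all three are used: H10 and smoothness in the Jacobian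
bound, H5 in the dichotomy.

References: D. McDuff, D. Salamon, *Introduction to Symplectic Topology*, 3rd ed. (2017),
Rem. 4.5.2 (viii) [McDuffSalamon2017]; M. Gromov, Invent. Math. 82 (1985), §0.3.C [Gromov1985].
-/

noncomputable section

-- the prescribed namespace `Summit.<P>.<Sub>.…` duplicates `SmoothPoincare4` (P = Sub)
set_option linter.dupNamespace false

open scoped Manifold ContDiff Topology
open Set TopologicalSpace Literature.Geometry.Kaehler Literature.Geometry.Symplectic

namespace Summit.SmoothPoincare4.SmoothPoincare4.Theorems.GromovRecognitionRelEnd.CrossCapLaurent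

/-- Model space `ℝ⁴ = ℂ²` (coordinates `0,1` = `z₁`, `2,3` = `z₂`). -/
local notation "E4" => EuclideanSpace ℝ (Fin 4)
/-- `ℝ² = ℂ`, the coordinate plane of one factor. -/
local notation "E2" => EuclideanSpace ℝ (Fin 2)

/-! ## The volume count: `M` is not compact -/

section Volume

variable {M : Type} [TopologicalSpace M] [T2Space M] [ChartedSpace E4 M] [IsManifold (𝓡 4) ∞ M]

open MeasureTheory in
/-- **The volume count.** Under H2 (`sf` smooth), H5 (sub-ends compact), H6–H9 (end chart) and
H10 (`sf = ψ*ω₀` on `Kᶜ`), the manifold `M` is NOT compact: `K` is closed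
(`isClosed_of_ends`), every point has an open neighbourhood whose end-piece
`{w | R < ‖w‖ ∧ χ w ∈ U}` has finite measure (`exists_nhds_volume_lt_top`), so compactness of
`M` would give finitely many pieces covering the whole end `{R < ‖w‖}` (as `χ` maps it into
`M`), of infinite measure (`volume_compl_closedBall_eq_top`) — contradiction. [folklore] -/
theorem not_compactSpace_of_end (sf : MForm (𝓡 4) M ℝ 2) (K : Set M) (R : ℝ)
    (ψ : M → E4) (χ : E4 → M) (h2 : IsSmoothForm sf)
    (h5 : ∀ R', R ≤ R' → IsCompact (K ∪ {x | ‖ψ x‖ ≤ R'}))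
    (h6 : ContMDiffOn (𝓡 4) 𝓘(ℝ, E4) ∞ ψ Kᶜ)
    (h7 : ContMDiffOn 𝓘(ℝ, E4) (𝓡 4) ∞ χ (Metric.closedBall (0 : E4) R)ᶜ)
    (h8 : Set.BijOn ψ Kᶜ (Metric.closedBall (0 : E4) R)ᶜ)
    (h9 : ∀ x, x ∈ Kᶜ → χ (ψ x) = x)
    (h10 : ∀ x, x ∈ Kᶜ → ∀ v w, sf x ![v, w] =
      stdSymplecticForm (mfderiv (𝓡 4) 𝓘(ℝ, E4) ψ x v) (mfderiv (𝓡 4) 𝓘(ℝ, E4) ψ x w)) :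
    ¬ CompactSpace M := by
  intro hM
  have hK : IsClosed K := isClosed_of_ends h5 h8.mapsTo
  choose U hUo hpU hvol using
    fun p => exists_nhds_volume_lt_top sf K R ψ χ h2 hK h6 h7 h8 h9 h10 p
  obtain ⟨t, ht⟩ := (isCompact_univ (X := M)).elim_finite_subcover U hUo
    (fun p _ => mem_iUnion.2 ⟨p, hpU p⟩)
  set T : Set E4 := (Metric.closedBall (0 : E4) R)ᶜ with hT
  have hcover : T ⊆ ⋃ p ∈ t, {w : E4 | w ∈ T ∧ χ w ∈ U p} := by
    intro w hw
    obtain ⟨p, hp, hwp⟩ := mem_iUnion₂.1 (ht (mem_univ (χ w)))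
    exact mem_iUnion₂.2 ⟨p, hp, hw, hwp⟩
  have hfin : volume T < ⊤ :=
    calc volume T ≤ volume (⋃ p ∈ t, {w : E4 | w ∈ T ∧ χ w ∈ U p}) := measure_mono hcover
      _ ≤ ∑ p ∈ t, volume {w : E4 | w ∈ T ∧ χ w ∈ U p} := measure_biUnion_finset_le t _
      _ < ⊤ := ENNReal.sum_lt_top.2 fun p _ => hvol p
  exact absurd (volume_compl_closedBall_eq_top R) hfin.ne

end Volume

/-! ## The stub -/

/-- **Stub 1 — the end does not return (S mathematically / M formally; the panel's COMMON FINDING,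
triage r1-2 and r1-3 §A4, = Disproof `resists` bullet 1).**  Under the end hypotheses of the crux
(`sf` a smooth 2-form equal to `ψ*ω₀` on `Kᶜ`, `ψ|Kᶜ` a smooth bijection onto `{R < ‖z‖}` with
smooth inverse `χ`, all sub-ends co-compact), for every `R' > R` the truncation
`K ∪ {x ∈ Kᶜ | ‖ψ x‖ < R'}` is OPEN in `M`; equivalently `χ {R' ≤ ‖w‖}` is closed in `M`, i.e. no
sequence `χ wₙ` with `‖wₙ‖ → ∞` accumulates at a point of `K`.  Proof: manifolds charted on `ℝ⁴`
are locally compact (`ChartedSpace.locallyCompactSpace`) and `C^∞` maps are continuous, so the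
topological dichotomy `noAccumulation_or_compactSpace` applies: either every truncation is open,
or `M` is compact; the latter is excluded by the volume count `not_compactSpace_of_end` (the
`ψ*ω₀`-volume of the end is infinite, while the continuous `sf` has locally finite chart volume).
Neither `π₂`, closedness nor non-degeneracy of `sf` is needed.  Honours Disproof
`_false_without_ends` / `_without_pullback` / `_without_smoothForm`: H5 enters the dichotomy, H10
and `IsSmoothForm sf` the Jacobian bound. [folklore] -/
theorem stub_endDoesNotReturn :
    ∀ (M : Type) [TopologicalSpace M] [T2Space M] [SecondCountableTopology M]
      [ChartedSpace E4 M] [IsManifold (𝓡 4) ∞ M]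
      (sf : MForm (𝓡 4) M ℝ 2) (K : Set M) (R : ℝ) (ψ : M → E4) (χ : E4 → M),
      IsSmoothForm sf →
      (∀ R', R ≤ R' → IsCompact (K ∪ {x | ‖ψ x‖ ≤ R'})) →
      ContMDiffOn (𝓡 4) 𝓘(ℝ, E4) ∞ ψ Kᶜ →
      ContMDiffOn 𝓘(ℝ, E4) (𝓡 4) ∞ χ (Metric.closedBall (0 : E4) R)ᶜ →
      Set.BijOn ψ Kᶜ (Metric.closedBall (0 : E4) R)ᶜ →
      (∀ x, x ∈ Kᶜ → χ (ψ x) = x) →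
      (∀ x, x ∈ Kᶜ → ∀ v w, sf x ![v, w] =
        stdSymplecticForm (mfderiv (𝓡 4) 𝓘(ℝ, E4) ψ x v) (mfderiv (𝓡 4) 𝓘(ℝ, E4) ψ x w)) →
      ∀ R', R < R' → IsOpen (K ∪ {x | x ∈ Kᶜ ∧ ‖ψ x‖ < R'}) := by
  intro M _ _ _ _ _ sf K R ψ χ h2 h5 h6 h7 h8 h9 h10
  haveI : LocallyCompactSpace M := ChartedSpace.locallyCompactSpace E4 M
  exact (noAccumulation_or_compactSpace K R ψ χ h5 h6.continuousOn h7.continuousOn h8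
    h9).resolve_right (not_compactSpace_of_end sf K R ψ χ h2 h5 h6 h7 h8 h9 h10)

end Summit.SmoothPoincare4.SmoothPoincare4.Theorems.GromovRecognitionRelEnd.CrossCapLaurent

end
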